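import Summits.CriticalPhenomena.PercolationContinuityZ3.Theorems.Transplant.BoxProdZ2ConcParamsRoot
import HarnessLib

/-!
# (S) More unpacking at the concrete choices, for the FACE residue (F)'s inner elongated routes (p3-g3's `faceOblR_concGB`, INNER block,
# 16:58Z): with the instantiation `s₁ := C.s`, `nmax := 12 K`, `R'A := R'`, `RlevA := M + L`, `ℓ₀ := M + 1`, `ℓ1 := M + s + 2R' + 1`,
# `ℓ₁A := 6t`, `L'A := ψ(6t) + ψ M`, `L_A := Conc.LAc`, `R₀A := ψ(6t)`, `R₁A := Conc.Rexc q (ψ(6t))`, `ηA := Conc.ηc` — the planar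
# arithmetic `hs / hs2 / hℓ1A / hsA / hn / hbig / h10s` and the radius facts `hLRA / hR₀A / hR₁LA` BY NAME, and `12 K ≤ nmaxA K`
# (companion of `BoxProdZ2ConcParamsAtQ` / `BoxProdZ2ConcParamsRoot`)

builds on p205010 (kernel theorem, internal audit signed; external expert review pending) — nothing in this file uses p205010.
Status sentence (coordinator 2026-08-20T04:30Z): "θ(p_c) = 0 on ℤ^d, all d ≥ 2 — kernel-verified (Lean 4/Mathlib, standard axioms); internal adversarial
audit SIGNED 2026-08-20 04:29Z; external expert review pending."
Lane `prim-bschramm-*`, seat `prim-bschramm-stmt` (gen 6); helper file (`--supports stmt-CriticalPhenomena-4575`).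
[cite: KozmaNitzan2024, §4 Theorem 6 (pp. 25–31), Lemma 11 (pp. 22–23), p. 30 (Step III)]
-/

noncomputable section

open MeasureTheory
open scoped Classical

namespace Summit.CriticalPhenomena.PercolationContinuityZ3.Theorems

namespace Transplant

namespace BoxProdZ2

open Literature.Probability.Percolation Literature.Probability.LatticeModels SimpleGraph KNCells KNLevels
open Literature.Barriers.CriticalPhenomena (IsQuasiTransitive IsGraphAmenable)

/-- `12 K ≤ nmaxA K` (the inner chains of the face step, `nmax := 12 K`, are served by `δA`). [folklore] -/
theorem nmax_face_le (K : ℕ) : 12 * K ≤ nmaxA K := by unfold nmaxA; omega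

namespace Conc

/-! ## Planar arithmetic of the inner routes -/

section Consts

variable {κ : ConcConsts} {W : Type} [Countable W] {X : SimpleGraph W} [X.LocallyFinite] {hqt : IsQuasiTransitive X}
  {p : unitInterval} {hT : TubeSubcritical X p} {δA : ℝ} {M : ℕ}

/-- `r = K · (400 (R' + 1))`. [folklore] -/
theorem Cc_r_eq : (Cc κ X hqt p hT δA M).r = Kof κ.K₀ * (400 * (R'c κ X hqt p hT δA M + 1)) := rfl

/-- `hs`: `R' + (M + 1) ≤ s` (`s₁ := s`, `ℓ₀ := M + 1`). [folklore] -/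
theorem face_hs : R'c κ X hqt p hT δA M + (M + 1) ≤ (Cc κ X hqt p hT δA M).s := by
  have h := lt_R'c (κ := κ) (X := X) (hqt := hqt) (p := p) (hT := hT) (δA := δA) (M := M)
  rw [Cc_s]; omega

/-- `hs2`: `2 R' ≤ s`. [folklore] -/
theorem face_hs2 : 2 * R'c κ X hqt p hT δA M ≤ (Cc κ X hqt p hT δA M).s := by
  rw [Cc_s]; omega

/-- `hℓ1A`: `ℓ1 := M + s + 2R' + 1 ≤ 6 t`. [folklore] -/
theorem face_hℓ1A : M + (Cc κ X hqt p hT δA M).s + 2 * R'c κ X hqt p hT δA M + 1 ≤ 6 * tc κ X hqt p hT δA M := by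
  have h1 := R'c_succ_le_tc (κ := κ) (X := X) (hqt := hqt) (p := p) (hT := hT) (δA := δA) (M := M)
  have h2 := lt_R'c (κ := κ) (X := X) (hqt := hqt) (p := p) (hT := hT) (δA := δA) (M := M)
  rw [Cc_s]; omega

/-- `hsA`: `s + R' ≤ 6 t`. [folklore] -/
theorem face_hsA : (Cc κ X hqt p hT δA M).s + R'c κ X hqt p hT δA M ≤ 6 * tc κ X hqt p hT δA M := by
  have h := face_hℓ1A (κ := κ) (X := X) (hqt := hqt) (p := p) (hT := hT) (δA := δA) (M := M); omega

/-- `hn`: `12 r ≤ nmax · s` with `nmax := 12 K` (equality, `r = K s`). [folklore] -/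
theorem face_hn : 12 * (Cc κ X hqt p hT δA M).r ≤ 12 * Kof κ.K₀ * (Cc κ X hqt p hT δA M).s := by
  rw [Cc_r_eq, Cc_s, Nat.mul_assoc]

/-- `hbig`: `Rlev + ℓ1 + 2 s + (nmax + 3) R' ≤ r` for `Rlev := M + L`, `ℓ1 := M + s + 2R' + 1`, `nmax := 12 K` (`K ≥ 20`). [folklore] -/
theorem face_hbig : (M + Lc κ X hqt p hT δA M) + (M + (Cc κ X hqt p hT δA M).s + 2 * R'c κ X hqt p hT δA M + 1) +
    2 * (Cc κ X hqt p hT δA M).s + (12 * Kof κ.K₀ + 3) * R'c κ X hqt p hT δA M ≤ (Cc κ X hqt p hT δA M).r := by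
  have hK := twenty_le_Kof κ.K₀
  have hR := lt_R'c (κ := κ) (X := X) (hqt := hqt) (p := p) (hT := hT) (δA := δA) (M := M)
  have hRL : R'c κ X hqt p hT δA M = M + Lc κ X hqt p hT δA M + 1 := rfl
  rw [Cc_r_eq, Cc_s]
  generalize hKdef : Kof κ.K₀ = K at hK ⊢
  generalize hRdef : R'c κ X hqt p hT δA M = R at hR hRL ⊢
  -- K-free part ≤ 7760 R + 8000 ≤ 388 K R + 400 K; the `12 K R` terms cancel
  have h1 : 7760 * R ≤ 388 * K * R := by
    have := Nat.mul_le_mul_right R (show 7760 ≤ 388 * K by omega)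
    simpa [Nat.mul_assoc] using this
  have h2 : 8000 ≤ 400 * K := by omega
  have h3 : K * (400 * (R + 1)) = 12 * K * R + (388 * K * R + 400 * K) := by ring
  have h4 : (12 * K + 3) * R = 12 * K * R + 3 * R := by ring
  rw [h3, h4]
  generalize 12 * K * R = A at *
  generalize 388 * K * R = B at *
  generalize 400 * K = D at *
  omega

/-- `h10s`: `Rlev + ℓ1 + 1 ≤ 10 s`. [folklore] -/
theorem face_h10s : (M + Lc κ X hqt p hT δA M) + (M + (Cc κ X hqt p hT δA M).s + 2 * R'c κ X hqt p hT δA M + 1) + 1 ≤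
    10 * (Cc κ X hqt p hT δA M).s := by
  have hR := lt_R'c (κ := κ) (X := X) (hqt := hqt) (p := p) (hT := hT) (δA := δA) (M := M)
  rw [Cc_s, R'c_eq] at *; omega

/-- `hR₀A`: `ψ M ≤ ψ (6 t)` (= `ψ_le_ψ_top`). [folklore] -/
theorem face_hR₀A : ψ X hqt p hT M ≤ ψ X hqt p hT (6 * tc κ X hqt p hT δA M) := ψ_le_ψ_top

end Consts

/-! ## The inner tube radius -/

section Sched

variable {κ : ConcConsts} {W : Type} [DecidableEq W] [Countable W] {X : SimpleGraph W} [X.LocallyFinite] {hqt : IsQuasiTransitive X}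
  {w : W} {p : unitInterval} {hT : TubeSubcritical X p} {δA : ℝ} {M : ℕ} {q : unitInterval}

/-- `hLRA`: `L'A := ψ (6t) + ψ M ≤ L_A := LAc`. [folklore] -/
theorem face_hLRA : ψ X hqt p hT (6 * tc κ X hqt p hT δA M) + ψ X hqt p hT M ≤ LAc κ X hqt w p hT δA M q := by
  unfold LAc; omega

/-- `hR₁LA`: `R₁A := Rexc q (ψ (6t)) ≤ L_A - L'A`. [folklore] -/
theorem face_hR₁LA : Rexc κ X hqt w p hT δA M q (ψ X hqt p hT (6 * tc κ X hqt p hT δA M)) ≤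
    LAc κ X hqt w p hT δA M q - (ψ X hqt p hT (6 * tc κ X hqt p hT δA M) + ψ X hqt p hT M) := by
  unfold LAc; omega

end Sched

end Conc

end BoxProdZ2

end Transplant

end Summit.CriticalPhenomena.PercolationContinuityZ3.Theorems

end
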